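import Literature.NumberTheory.EllipticCurves.CasselsTateSelmerKolyvaginValue
import Summits.BirchSwinnertonDyer.BirchSwinnertonDyer.Theorems.ThetaPartnerAtTwoSignedControlAtTwoCasselsLocalTerms
import HarnessLib

/-!
# Route `GenusKolyvaginAtTwo`, crux L_T `PowDvdShaCardAtTwoRT` (stmt-BirchSwinnertonDyer-23299), LINE 18, road (E4) — socket X-ORTH, Kummer input:
# the kernel of `[m]_* : 𝓛_E^{(m²)} → 𝓛_E^{(m)}` on the local Kummer condition is `m · 𝓛_E^{(m²)}`

Seat `bsd-line-gk2-p4` g20 (WIDTH-5 attach, cell `bsd-f1-sign2`), `--supports` the crux L_T (helper; closes nothing).  THEOREMS ONLY (no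
definition, no named fact, no `sorry`); BSD is not proved by any of this; neither is L_T nor any stub.

WHY (memo `Cruxes/PowDvdShaCardAtTwoRT/Lines/plus-descent-deep-orthogonality-gk2p4.md` §7, `…RTCrossPairVanishing` §3, `…RTCrossPairNaturality`).
The CROSS local term of McCallum's Prop. 4.7 vanishes once the Kummer lift `β′_λ ∈ 𝓛_λ^{(m²)}` (`[m]_* β′_λ = loc_λ b′`) is `(−s)`-eigen MODULO
`m·𝓛_λ^{(m²)}`.  `…RTCrossPairNaturality` gives `[m]_*(σ_*β′ − (−s)·β′) = 0`; this file supplies the last generic input: on the local Kummer condition,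
`ker [m]_* = m·𝓛^{(m²)}` — in points: `κ_{m²}(Q)` with `κ_m(mQ) = 0` means `mQ = R + T` with `R ∈ E(E)`, `T ∈ E[m]`; replacing `Q` by `Q − T₁`
(`mT₁ = T`, same class) one may take `T = 0`, and then `κ_{m²}(Q) = m·κ_{m²}(Q₃)` for an `m`-th root `Q₃` of `Q` (`m²Q₃ = mQ = R` rational).
* uses `SignedEC.CasselsPT.localKummerClass_nsmul` (`κ_n(j·Q) = j·κ_n(Q)`, tree).
* **`exists_eq_zsmul_of_mem_kummer_of_map_mulK_eq_zero`** — `Y ∈ 𝓛_E^{(m²)}`, `[m]_* Y = 0` ⟹ `Y = m·Y₂` with `Y₂ ∈ 𝓛_E^{(m²)}`;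
  `exists_eq_zsmul_of_mem_kummer_of_map_mulK_sub_eq_zero` — the form consumed by X-ORTH: `Y, Y₀ ∈ 𝓛`, `[m]_*(Y − Y₀·?)`… precisely
  `[m]_* Z = 0` for `Z := σ_*β′ + s·β′ ∈ 𝓛` ⟹ `Z = m·Y′`, `Y′ ∈ 𝓛`.

References: [SilvermanAEC2009] VIII §2, X §4 (exactness of the Kummer sequence); [MilneADT2006] I §6 proof of Prop. 6.9 (the lifts `b_{v,1}`).
-/

set_option autoImplicit false

noncomputable section

open scoped Classical
open Function Field WeierstrassCurve
open Literature.NumberTheory.EllipticCurves Literature.NumberTheory.GaloisRepresentations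
open Literature.NumberTheory.GaloisCohomology

-- the Theorems namespace of this sub repeats the summit name by design (D-0017 nested layout)
set_option linter.dupNamespace false

universe u

namespace Summit.BirchSwinnertonDyer.BirchSwinnertonDyer.Theorems.GenusExact.PlusDescent

variable {K : Type u} [Field K] [CharZero K] (W : WeierstrassCurve K) [W.IsElliptic]
variable (E : Type u) [Field E] [Algebra K E]

variable (m : ℕ) [NeZero m]

/-- **On the local Kummer condition, `ker [m]_* = m·𝓛^{(m²)}`.**  If `Y ∈ 𝓛_E^{(m²)}` and `[m]_* Y = 0` in `H¹(Γ_E, E[m])`, then `Y = m·Y₂` for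
some `Y₂ ∈ 𝓛_E^{(m²)}` (`Y = κ(Q)`; `κ_m(mQ) = 0` gives `mQ − T` rational with `mT = 0`; `Q − T₁`, `mT₁ = T`, has the same class and an
`m`-th root `Q₃` with `m²Q₃` rational; `Y = m·κ(Q₃)`). [cite: SilvermanAEC2009, VIII §2, X §4] [cite: MilneADT2006, Ch. I §6, proof of Prop. 6.9] -/
theorem exists_eq_zsmul_of_mem_kummer_of_map_mulK_eq_zero
    {Y : galoisCohomology (GaloisRep.restrictField E (W.torsionGaloisModule ((m * m : ℕ) : ℤ))) 1}
    (hY : Y ∈ W.kummerLocalConditionAt ((m * m : ℕ) : ℤ) E)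
    (hker : galoisCohomology.map ((mulK W m m).restrictField E) 1 Y = 0) :
    ∃ Y₂ ∈ W.kummerLocalConditionAt ((m * m : ℕ) : ℤ) E, Y = (m : ℤ) • Y₂ := by
  have hm : (m : ℤ) ≠ 0 := Int.natCast_ne_zero.mpr (NeZero.ne m)
  have hmm : ((m * m : ℕ) : ℤ) ≠ 0 := Int.natCast_ne_zero.mpr (NeZero.ne (m * m))
  have hmm' : (m : ℤ) * (m : ℤ) ≠ 0 := mul_ne_zero hm hm
  obtain ⟨Q, hQ, rfl⟩ := W.exists_eq_localKummerClass_of_mem ((m * m : ℕ) : ℤ) hmm hY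
  -- `[m]_* κ_{m²}(Q) = κ_m(m Q) = 0`
  have hQ1 : ((m : ℤ) * (m : ℤ)) • Q ∈ MulAction.fixedPoints (absoluteGaloisGroup E) (localPoints W E) := by
    rw [← Nat.cast_mul]; exact hQ
  have hQm : (m : ℤ) • ((m : ℤ) • Q) ∈ MulAction.fixedPoints (absoluteGaloisGroup E) (localPoints W E) := by
    rw [← mul_smul]; exact hQ1
  have h0 : W.localKummerClass (m : ℤ) hm ((m : ℤ) • Q) hQm = 0 := by
    rw [← W.map_torsionMulBy_localKummerClass (m : ℤ) (m : ℤ) hmm' hm Q hQ1 hQm]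
    exact hker
  -- `m Q − T` is rational for some `m`-torsion `T`; divide `T` by `m`
  obtain ⟨T, hT, hrat⟩ := (W.localKummerClass_eq_zero_iff (m : ℤ) hm _ hQm).mp h0
  obtain ⟨T₁, hT₁⟩ : ∃ T₁ : localPoints W E, (m : ℤ) • T₁ = T :=
    (W.baseChange (AlgebraicClosure E)).zsmul_surjective_of_isAlgClosed hm T
  -- `Q₂ := Q − T₁` has the same class and `m Q₂` rational
  have hQ₂m : (m : ℤ) • (Q - T₁) ∈ MulAction.fixedPoints (absoluteGaloisGroup E) (localPoints W E) := by
    rw [smul_sub, hT₁]; exact hrat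
  have hQ₂ : ((m * m : ℕ) : ℤ) • (Q - T₁) ∈ MulAction.fixedPoints (absoluteGaloisGroup E) (localPoints W E) := by
    rw [Nat.cast_mul, mul_smul]
    exact fun σ ↦ by rw [smul_zsmul_localPoints, hQ₂m σ]
  have hsame : ((m * m : ℕ) : ℤ) • Q = ((m * m : ℕ) : ℤ) • (Q - T₁) := by
    have hT0 : ((m * m : ℕ) : ℤ) • T₁ = 0 := by
      rw [Nat.cast_mul, mul_smul, hT₁]; exact hT
    rw [smul_sub, hT0, sub_zero]
  -- an `m`-th root `Q₃` of `Q₂`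
  obtain ⟨Q₃, hQ₃⟩ : ∃ Q₃ : localPoints W E, (m : ℤ) • Q₃ = Q - T₁ :=
    (W.baseChange (AlgebraicClosure E)).zsmul_surjective_of_isAlgClosed hm (Q - T₁)
  have hQ₃fix : ((m * m : ℕ) : ℤ) • Q₃ ∈ MulAction.fixedPoints (absoluteGaloisGroup E) (localPoints W E) := by
    rw [Nat.cast_mul, mul_smul, hQ₃]; exact hQ₂m
  refine ⟨W.localKummerClass ((m * m : ℕ) : ℤ) hmm Q₃ hQ₃fix, W.localKummerClass_mem_kummerLocalConditionAt _ hmm Q₃ hQ₃fix, ?_⟩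
  have hQ₃' : m • Q₃ = Q - T₁ := by rw [← natCast_zsmul]; exact hQ₃
  have hmQ₃ : ((m * m : ℕ) : ℤ) • (m • Q₃) ∈ MulAction.fixedPoints (absoluteGaloisGroup E) (localPoints W E) := by
    rw [hQ₃']; exact hQ₂
  rw [W.localKummerClass_eq_of_zsmul_eq ((m * m : ℕ) : ℤ) hmm Q (Q - T₁) hQ hQ₂ hsame, natCast_zsmul,
    ← SignedEC.CasselsPT.localKummerClass_nsmul W ((m * m : ℕ) : ℤ) hmm m Q₃ hQ₃fix hmQ₃]
  exact localKummerClass_congr hQ₃'.symm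

end Summit.BirchSwinnertonDyer.BirchSwinnertonDyer.Theorems.GenusExact.PlusDescent

end
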